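import Summits.QuantumFields.QCD.Theorems.TiltedFlatness.Negative.FreeStarFibre

/-!
# Crux `TiltedFlatness` (K3 of route `PauliWegnerSea`), negative side — clause (a) needs its loss

Support file of the standing disprover of item stmt-QuantumFields-14070 (the REPAIRED crux `C′`:
relative flatness (a) `F(W₀) ≤ C(1+β)^p M_β` and relative small balls (b′)
`ν_β(F ≤ εM_β) ≤ C(1+β)^p ε^c` on the two-star fibre, constants uniform in `β`, masses, volume and
outside).  Load-bearing analysis of clause (a): its `(1+β)^p` loss cannot be dropped.

**Theorem `not_flatnessClause_uniform`.**  Clause (a) with loss exponent `p = 0` (everything else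
verbatim) is FALSE.  Witness fibre: `N_f = 1`, `m = 0`, `L = 4`, trivial outside `U ≡ 1`, one star
(`x = y = 0`).

* `freeStar_pureGauge`: a field that is `1` off the star of the origin and FLAT is pure gauge at
  the origin (forward links `h`, backward links `h⁻¹`) — seven plaquettes through the star;
* `det_wilsonDirac_freeStar_eq_zero`: such a field carries the parallel colour field
  `ψ(0) = h e₁`, `ψ(z) = e₁` (`z ≠ 0`), so by the massless kernel theorem
  (`det_wilsonDirac_massless_eq_zero_iff`, file `MasslessKernel`) its massless Wilson determinant
  vanishes: the fermionic weight `F` is ZERO on every minimiser of the star action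
  (`flat_of_wilsonAction_eq_zero`, `wilsonAction_const_one`);
* `det_wilsonDirac_twisted_ne_zero`: twisting the single link `(0, ê₀)` by the centre-free
  element `diag(i, i, −1) ∈ SU(3)` leaves NO parallel field (`ψ` is shift-invariant along
  `ê₁, ê₂, ê₃`, along `ê₀` away from the origin, and the twist kills the common value), so `F > 0`
  there;
* `tilted_mean_le`: soft Laplace principle (from `laplace_concentration`, file `TwoWellFloor`):
  an amplitude vanishing on all minimisers of the phase has tilted mean `M_β → 0`.

Hence `sup F / M_β → ∞` on this fibre and no `β`-uniform constant exists; the crux's `(1+β)^p`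
(any `p ≥` the transversal vanishing order would do) is genuinely needed.

Companion: `NfDependence.lean` (the constants cannot be uniform in `N_f`).  The fibre facts live
in `FreeStarFibre.lean`.  Standard material. [folklore]
-/

namespace Summit.QuantumFields.QCD.Theorems.TiltedFlatnessNegative

open Matrix
open Literature.MathematicalPhysics.QuantumFieldTheory Literature.MathematicalPhysics.QuantumLattice
  Literature.Probability.LatticeModels

section NoLoss

/-! ### Laplace: the tilted mean of an amplitude vanishing on the minimisers tends to zero -/

section Laplace

variable {X : Type*} [TopologicalSpace X] [CompactSpace X] [MeasurableSpace X]
  [OpensMeasurableSpace X]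

/-- **Tilted means vanish in the cold limit on the zero set of the minimisers.**  If the
continuous amplitude `F ≥ 0` vanishes at every global minimiser of the continuous phase `S`,
then for every `η > 0` some tilt `β ≥ 0` has tilted mean `M_β = ∫ F e^{-βS} / ∫ e^{-βS} ≤ η`.
[folklore] -/
theorem tilted_mean_le (μ : MeasureTheory.Measure X) [MeasureTheory.IsFiniteMeasure μ]
    [μ.IsOpenPosMeasure] [Nonempty X] {S F : X → ℝ} (hS : Continuous S) (hF : Continuous F)
    (hF0 : ∀ z, 0 ≤ F z) (hmin : ∀ z, (∀ w, S z ≤ S w) → F z = 0) {η : ℝ} (hη : 0 < η) :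
    ∃ β : ℝ, 0 ≤ β ∧
      (∫ z, F z * Real.exp (-(β * S z)) ∂μ) / (∫ z, Real.exp (-(β * S z)) ∂μ) ≤ η := by
  open MeasureTheory Set Filter in
  obtain ⟨B, hB⟩ := isCompact_univ.exists_bound_of_continuousOn hF.continuousOn
  have hB' : ∀ z, F z ≤ B := fun z => (le_abs_self _).trans ((Real.norm_eq_abs _).symm.le.trans
    (hB z (mem_univ z)))
  have hB0 : 0 ≤ B := (hF0 (Classical.arbitrary X)).trans (hB' _)
  set V : Set X := {z | F z < η / 2} with hV
  have hVo : IsOpen V := isOpen_lt hF continuous_const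
  have hminV : ∀ z, (∀ w, S z ≤ S w) → z ∈ V := fun z hz => by
    show F z < η / 2
    rw [hmin z hz]; positivity
  obtain ⟨β, hβ0, hconc⟩ := laplace_concentration μ hS hVo hminV
    (show (0 : ℝ) < η / (2 * (B + 1)) by positivity)
  refine ⟨β, hβ0, ?_⟩
  have hc := hconc β le_rfl
  have hwc : Continuous fun z => Real.exp (-(β * S z)) :=
    Real.continuous_exp.comp ((continuous_const.mul hS).neg)
  have hwi : Integrable (fun z => Real.exp (-(β * S z))) μ := integrable_of_continuous hwc
  have hFwi : Integrable (fun z => F z * Real.exp (-(β * S z))) μ :=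
    integrable_of_continuous (hF.mul hwc)
  set Z : ℝ := ∫ z, Real.exp (-(β * S z)) ∂μ with hZ
  have hZnn : 0 ≤ Z := integral_nonneg fun z => (Real.exp_pos _).le
  by_cases hZ0 : Z = 0
  · rw [hZ0, div_zero]; exact hη.le
  have hZpos : 0 < Z := lt_of_le_of_ne hZnn (Ne.symm hZ0)
  rw [div_le_iff₀ hZpos]
  -- split the numerator over `V` and `Vᶜ`
  have hsplit := integral_add_compl hVo.measurableSet hFwi
  have hV_le : ∫ z in V, F z * Real.exp (-(β * S z)) ∂μ ≤ (η / 2) * Z := by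
    have h1 : ∫ z in V, F z * Real.exp (-(β * S z)) ∂μ ≤
        ∫ z in V, (η / 2) * Real.exp (-(β * S z)) ∂μ :=
      setIntegral_mono_on hFwi.integrableOn (hwi.const_mul _).integrableOn hVo.measurableSet
        fun z hz => mul_le_mul_of_nonneg_right (le_of_lt hz) (Real.exp_pos _).le
    rw [integral_const_mul] at h1
    refine h1.trans (mul_le_mul_of_nonneg_left ?_ (by positivity))
    exact setIntegral_le_integral hwi (Eventually.of_forall fun z => (Real.exp_pos _).le)
  have hVc_le : ∫ z in Vᶜ, F z * Real.exp (-(β * S z)) ∂μ ≤ B * (η / (2 * (B + 1)) * Z) := by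
    have h1 : ∫ z in Vᶜ, F z * Real.exp (-(β * S z)) ∂μ ≤
        ∫ z in Vᶜ, B * Real.exp (-(β * S z)) ∂μ :=
      setIntegral_mono_on hFwi.integrableOn (hwi.const_mul _).integrableOn
        hVo.isClosed_compl.measurableSet
        fun z _ => mul_le_mul_of_nonneg_right (hB' z) (Real.exp_pos _).le
    rw [integral_const_mul] at h1
    exact h1.trans (mul_le_mul_of_nonneg_left hc hB0)
  have hB1 : (B + 1) ≠ 0 := ne_of_gt (by positivity)
  have hfrac : B * (η / (2 * (B + 1))) ≤ η / 2 := by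
    rw [show B * (η / (2 * (B + 1))) = (B / (B + 1)) * (η / 2) by field_simp]
    have : B / (B + 1) ≤ 1 := (div_le_one (by positivity)).mpr (by linarith)
    exact mul_le_of_le_one_left (by positivity) this
  calc ∫ z, F z * Real.exp (-(β * S z)) ∂μ
      = ∫ z in V, F z * Real.exp (-(β * S z)) ∂μ + ∫ z in Vᶜ, F z * Real.exp (-(β * S z)) ∂μ :=
        hsplit.symm
    _ ≤ (η / 2) * Z + B * (η / (2 * (B + 1)) * Z) := add_le_add hV_le hVc_le
    _ = (η / 2) * Z + (B * (η / (2 * (B + 1)))) * Z := by ring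
    _ ≤ (η / 2) * Z + (η / 2) * Z := by gcongr
    _ = η * Z := by ring

end Laplace

/-! ### Clause (a) without its loss is false -/

/-- **Clause (a) of `TiltedFlatness` needs its `(1+β)^p` loss.**  The β-UNIFORM relative
flatness `F(W₀) ≤ C · M_β` (clause (a) of the crux with loss exponent `p = 0`, everything else
verbatim) is FALSE.  Witness: `N_f = 1`, `m = 0`, `L = 4`, trivial outside field `U ≡ 1`, one star
(`x = y = 0`).  The minimisers of the star action are the flat completions, which are pure gauge at
the origin (`freeStar_pureGauge`) and therefore carry a parallel colour field, so the massless
Wilson determinant VANISHES on all of them (`det_wilsonDirac_freeStar_eq_zero`, via the kernel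
theorem `det_wilsonDirac_massless_eq_zero_iff`); Laplace concentration (`tilted_mean_le`) then
drives the tilted mean `M_β → 0` as `β → ∞`, while the single centre-free twist `diag(i,i,−1)` of
the link `(0, ê₀)` has `F > 0` (`det_wilsonDirac_twisted_ne_zero`).  Hence `sup F / M_β → ∞`:
any proof of clause (a) must spend a `β`-dependent constant (the crux allows `(1+β)^p`).
[folklore] -/
theorem not_flatnessClause_uniform :
    ¬ (∀ Nf : ℕ, ∃ C : ℝ, 0 < C ∧ ∀ β : ℝ, 0 ≤ β → ∀ mq : Fin Nf → ℝ,
        (∀ f, -2 ≤ mq f ∧ mq f ≤ 2) → ∀ (L : ℕ) [NeZero L], 4 ≤ L →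
        ∀ (U : GaugeConfig 4 L (Matrix.specialUnitaryGroup (Fin 3) ℂ)) (x y : TorusSite 4 L),
        let star : Edge 4 L → Prop := fun e =>
          e.1 = x ∨ Site.shift e.1 e.2 = x ∨ e.1 = y ∨ Site.shift e.1 e.2 = y
        let refit : GaugeConfig 4 L (Matrix.specialUnitaryGroup (Fin 3) ℂ) →
            GaugeConfig 4 L (Matrix.specialUnitaryGroup (Fin 3) ℂ) :=
          fun W e => if star e then W e else U e
        let F : GaugeConfig 4 L (Matrix.specialUnitaryGroup (Fin 3) ℂ) → ℝ :=
          fun W => ‖(diracMatrix (refit W) mq).det‖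
        let wt : GaugeConfig 4 L (Matrix.specialUnitaryGroup (Fin 3) ℂ) → ℝ :=
          fun W => Real.exp (-(β * wilsonAction (fundamentalRep (Fin 3)) (refit W)))
        let haar : MeasureTheory.Measure (GaugeConfig 4 L (Matrix.specialUnitaryGroup (Fin 3) ℂ)) :=
          MeasureTheory.Measure.pi fun _ => haarProbability (Matrix.specialUnitaryGroup (Fin 3) ℂ)
        let Z : ℝ := ∫ W, wt W ∂haar
        let M : ℝ := (∫ W, F W * wt W ∂haar) / Z
        ∀ W₀ : GaugeConfig 4 L (Matrix.specialUnitaryGroup (Fin 3) ℂ), F W₀ ≤ C * M) := by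
  intro hyp
  obtain ⟨C, hC, H⟩ := hyp 1
  -- the concrete fibre: `L = 4`, trivial outside, star of the origin, one massless flavour
  let refit : GaugeConfig 4 4 SU3 → GaugeConfig 4 4 SU3 := fun W e =>
    if (e.1 = (0 : TorusSite 4 4) ∨ Site.shift e.1 e.2 = 0 ∨ e.1 = 0 ∨ Site.shift e.1 e.2 = 0)
    then W e else (fun _ : Edge 4 4 => (1 : SU3)) e
  let Fc : GaugeConfig 4 4 SU3 → ℝ := fun W =>
    ‖(diracMatrix (refit W) (fun _ : Fin 1 => (0 : ℝ))).det‖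
  let Sc : GaugeConfig 4 4 SU3 → ℝ := fun W => wilsonAction (fundamentalRep (Fin 3)) (refit W)
  let haar : MeasureTheory.Measure (GaugeConfig 4 4 SU3) :=
    MeasureTheory.Measure.pi fun _ => haarProbability SU3
  have Hβ : ∀ β : ℝ, 0 ≤ β → ∀ W₀ : GaugeConfig 4 4 SU3,
      Fc W₀ ≤ C * ((∫ W, Fc W * Real.exp (-(β * Sc W)) ∂haar) /
        (∫ W, Real.exp (-(β * Sc W)) ∂haar)) :=
    fun β hβ W₀ => H β hβ (fun _ => 0) (fun _ => by norm_num) 4 le_rfl (fun _ => 1) 0 0 W₀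
  -- continuity and non-negativity on the compact fibre
  have hrefit_cont : Continuous refit := by
    refine continuous_pi fun e => ?_
    by_cases h : (e.1 = (0 : TorusSite 4 4) ∨ Site.shift e.1 e.2 = 0 ∨ e.1 = 0 ∨
        Site.shift e.1 e.2 = 0)
    · simp only [refit, if_pos h]; exact continuous_apply e
    · simp only [refit, if_neg h]; exact continuous_const
  have hS : Continuous Sc := continuous_wilsonAction_comp hrefit_cont
  have hF : Continuous Fc := continuous_normDet_comp hrefit_cont _
  have hF0 : ∀ W, 0 ≤ Fc W := fun W => norm_nonneg _
  -- off-star values, the free minimum and the structural zero on minimisers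
  have hoff : ∀ (W : GaugeConfig 4 4 SU3) (e : Edge 4 4),
      ¬ (e.1 = 0 ∨ Site.shift e.1 e.2 = 0 ∨ e.1 = 0 ∨ Site.shift e.1 e.2 = 0) → refit W e = 1 := by
    intro W e he; simp only [refit, if_neg he]
  have hrefit_one : refit (fun _ => 1) = fun _ => 1 := by
    funext e; simp only [refit]; split_ifs <;> rfl
  have hSmin0 : Sc (fun _ => 1) = 0 := by
    show wilsonAction (fundamentalRep (Fin 3)) (refit fun _ => 1) = 0
    rw [hrefit_one]; exact wilsonAction_const_one
  have hFc_eq : ∀ W, Fc W = ‖(wilsonDirac (fundamentalRep (Fin 3)) (refit W) 0 1).det‖ := by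
    intro W
    show ‖(diracMatrix (refit W) (fun _ : Fin 1 => (0 : ℝ))).det‖ = _
    rw [norm_det_diracMatrix, Fin.prod_univ_one]
  have hmin : ∀ W, (∀ W', Sc W ≤ Sc W') → Fc W = 0 := by
    intro W hW
    have hS0 : Sc W = 0 := le_antisymm (hSmin0 ▸ hW (fun _ => 1)) (wilsonAction_nonneg' _)
    rw [hFc_eq, norm_eq_zero]
    exact det_wilsonDirac_freeStar_eq_zero (refit W) (hoff W) (flat_of_wilsonAction_eq_zero _ hS0)
  -- the twisted configuration has positive weight
  let Wtw : GaugeConfig 4 4 SU3 := fun e => if e = ((0 : TorusSite 4 4), (0 : Fin 4)) then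
    (⟨Matrix.diagonal ![Complex.I, Complex.I, -1], twist_mem_specialUnitaryGroup⟩ : SU3) else 1
  have hrefit_tw : refit Wtw = Wtw := by
    funext e
    by_cases he : (e.1 = (0 : TorusSite 4 4) ∨ Site.shift e.1 e.2 = 0 ∨ e.1 = 0 ∨
        Site.shift e.1 e.2 = 0)
    · simp only [refit, if_pos he]
    · have hne : e ≠ ((0 : TorusSite 4 4), (0 : Fin 4)) := by
        rintro rfl; exact he (Or.inl rfl)
      simp only [refit, if_neg he, Wtw, if_neg hne]
  have hpos : 0 < Fc Wtw := by
    rw [hFc_eq, hrefit_tw]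
    exact norm_pos_iff.mpr det_wilsonDirac_twisted_ne_zero
  -- Laplace: some tilt makes the mean smaller than `Fc Wtw / (2C)`
  haveI : haar.IsOpenPosMeasure := by
    show (MeasureTheory.Measure.pi fun _ : Edge 4 4 => haarProbability SU3).IsOpenPosMeasure
    unfold haarProbability; infer_instance
  obtain ⟨β, hβ0, hM⟩ := tilted_mean_le haar hS hF hF0 hmin
    (div_pos hpos (mul_pos two_pos hC))
  have h1 := Hβ β hβ0 Wtw
  have h2 : C * ((∫ W, Fc W * Real.exp (-(β * Sc W)) ∂haar) /
      (∫ W, Real.exp (-(β * Sc W)) ∂haar)) ≤ C * (Fc Wtw / (2 * C)) :=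
    mul_le_mul_of_nonneg_left hM hC.le
  have h3 : C * (Fc Wtw / (2 * C)) = Fc Wtw / 2 := by field_simp
  linarith

end NoLoss

end Summit.QuantumFields.QCD.Theorems.TiltedFlatnessNegative
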